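import Summits.BirchSwinnertonDyer.BirchSwinnertonDyer.Theorems.BiquadraticEisensteinDescentHeegnerTwistCouplingInSupplyKrizLiCornerQT27
import Summits.BirchSwinnertonDyer.BirchSwinnertonDyer.Theorems.PrintCFramJZeroThreeUnitRegimeValuePsi
import Summits.BirchSwinnertonDyer.BirchSwinnertonDyer.Theorems.PrintCFramJZeroThreeUnitRegimeKroneckerCharacters
import HarnessLib

set_option linter.dupNamespace false -- `Summit.BirchSwinnertonDyer.BirchSwinnertonDyer.Theorems.…` (summit = sub, D-0017)
set_option autoImplicit false

/-!
# Crux `HeegnerTwistCouplingInSupply` (stmt-BirchSwinnertonDyer-21381) — the `j = 0` quadratic-twist corners X12₊ ∪ QT27₊ at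
# `q ≡ 11 (mod 12)` through the KRIZ–LI DOOR: `W ≅ y² = x³ + q·m²` (`36a1^{(q)} = x³ + q³`: `m = q`; `27a^{(q)}`: `m = 4q`),
# `ψ = χ₄·(·/q)` (the EVEN character of conductor `4q`), Heegner field `ℚ(√−r)`, MODULO PRINT ONLY

Route `BiquadraticEisensteinDescent` (cell `pub/bsd-wall`, width seat `bsd-wall-cm-bed-w4` g27; `--supports` 21381, helper;
KL3-CORNERS-bsd-idea-18-g21 §3 «kernel option `cruxOnX12Plus_of_facts`»). Companion of `…KrizLiCornerQT27.lean` (the case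
`q ≡ 5 (mod 12)`, `ψ = (·/q)`). For `q ≡ 3 (mod 4)` the `3`-isogeny character of `y² = x³ + q·m²` is `ψ = χ_{ℚ(√q)} = χ₄·(·/q)`,
of conductor `4q` and EVEN; Kriz–Li (1) at `p_KL = 3` reads `ψ(3) = χ₄(3)·(3/q) = −(3/q) ≠ 1`, i.e. `(3/q) = +1`, i.e.
`q ≡ 11 (mod 12)` (then `q ≡ 2 (mod 3)`: CM-inert). The cell `bsd-print-cfram` proved the VALUE-FUNCTION class theorem
`PrintCFram.bsdp_three_of_unitRegime_valuePsi` and the `q = 11` character `χ₄₄` (`…KroneckerCharacters`); this file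

* §1 builds `χ_{4q} = χ₄↑·(·/q)↑` for EVERY odd prime `q` (`exists_chiFourMul_three`: primitive, quadratic, values
  `χ₄(a)·J(a | q)`), its value at `3` (`chiFourMul_val_three`), evenness for `q ≡ 3 (mod 4)` (`chiFourMul_even`) and the
  trace-form compatibility `χ₄(ℓ)·J(ℓ | q) = J(q | ℓ)` (`chiFourMul_eq_jacobiSym`, reciprocity for `q ≡ 3 (mod 4)`) — the
  `χ₄₄` lemmas of the cell with `11 ↦ q`;
* §2 ★ `heegner_and_twist_L_one_ne_zero_of_valuePsi`: the Kriz–Li door (`KrizLiCornerQT27.twist_L_one_ne_zero_of_thm120_three`)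
  behind the cell's value-function plumbing — for a primitive quadratic `ψ` of level `f ⊥ 3` given by integer values `v` with
  `v(3) = −1`, trace-form compatibility `v(ℓ) = J(d | ℓ)` at `ℓ ≡ 1 (mod 3)`, a Heegner prime `r ≡ 3 (mod 4)` (`3` and every
  `ℓ ∣ f` split in `ℚ(√−r)`), the Bernoulli binder `hB` for `ε_K = χ_r↑`, and every globally minimal `W ≅ y² = x³ + d·m²` with bad
  primes `3 ∣ f ∣ listed` and `r_an(W) ≠ 0`: `K` Heegner, `L(W^{(d_K)}, 1) ≠ 0`, `r_an(W^{(d_K)}) = 0` — modulo `hKL`, `hGZ`, `hHP`;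
* §3 ★ `heegner_and_twist_L_one_ne_zero_of_prime_pair_three_mod_four` / ★ `exists_cruxConclusion_of_prime_pair_three_mod_four`:
  `q ≡ 3 (mod 4)` prime with `J(3 | q) = 1`, `r ≡ 7 (mod 8)` prime, `r ≠ 3`, `J(−r | 3) = J(−r | q) = 1`, the certificates
  `3 ∤ S₁ = Σ_{j<4qr} χ₄(j)(j/q)(j/r)·j` (`= −4qr·h(−4qr)`: `3 ∤ h(−4qr)`) and `3 ∥ S₂ = Σ_{j<12q} χ₄(j)(j/q)(j/3)·j` (`= −12q·h(−12q)`: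
  the KL3-regularity `3 ∤ h(−12q)` of KL3-CORNERS §1), `h(−r) < q`: for every globally minimal `W ≅ y² = x³ + q·m²` with bad primes
  `⊂ {2, 3, q}`, `a₂(W) = 0` if good at `2`, `r_an(W) ≠ 0`: the CONCLUSION of crux 21381 at `(W, q)`.
  Instances (`q = 47, 59, 71, 107, …`; `q = 11` has no PRIME certificate with `h(−r) < 11` — KL3-CORNERS' `d = −95` is composite;
  `q = 83, 131, 179, 251` are irregular) are in the companion `…KrizLiCornerX12Instances.lean`.

HONEST FRAMING: a typed sub-corner on one more CM family pair (measure zero in «all CM `W`»); conditional on three REFEREED named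
facts (Kriz–Li 2019 Thm. 1.20, Gross–Zagier, Heegner points over `K`); per-curve binders `hW`/`h6`/`h2`/`hS` displayed as in the
cell `bsd-print-cfram`'s class theorems; the crux (C⁺ / (S3′)(p) for all `p`), its registered stubs and BSD are NOT proved by any of
this. THEOREMS ONLY (no `def`, no named fact, no sorry). Supports stmt-BirchSwinnertonDyer-21381.
[cite: KrizLi2019, Thm. 1.20 (pp. 7–8), §1.5 (1), §7.1 (p. 42), §10.3] [cite: GrossZagier1986, Thm. I.(6.3), V.§1–2]
[cite: Cox2013, §1.C Lemma 1.14 and (1.15)–(1.18)] [cite: MontgomeryVaughan2007, Theorem 9.13] [cite: Washington1997, Thm. 4.2]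
-/

noncomputable section

open scoped Classical NumberTheorySymbols

namespace Summit.BirchSwinnertonDyer.BirchSwinnertonDyer.Theorems.KrizLiCornerX12

open _root_.WeierstrassCurve NumberField Field DirichletCharacter
open Literature.NumberTheory.EllipticCurves Literature.NumberTheory.EllipticCurves.KrizLi2019
  Literature.NumberTheory.EllipticCurves.ModularForms Literature.NumberTheory.QuadraticFields
  Literature.NumberTheory.QuadraticFields.Quadratic
  Summit.BirchSwinnertonDyer.Rank1Residual.X12.O11.RouteU
  Summit.BirchSwinnertonDyer.Rank1Residual.X12
  Summit.BirchSwinnertonDyer.BirchSwinnertonDyer.Theorems.PrintCFram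
  Summit.BirchSwinnertonDyer.BirchSwinnertonDyer.Theorems.KrizLiCornerQT27

/-! ## §1 The even character `χ_{4q} = χ₄↑·(·/q)↑` of conductor `4q` with values in `ℚ₃` -/

section ChiFourMul

/-- **`χ_{4q}` as a `ℚ₃`-valued Dirichlet character mod `4q`** (`q` an odd prime) with values `χ(a) = χ₄(a)·J(a | q)` — the
character of `ℚ(√±q)` of discriminant `±4q`; primitive and quadratic (the cell `bsd-print-cfram`'s `exists_chiFortyFour_three`
with `11 ↦ q`). [cite: Cox2013, §1.C Lemma 1.14 and (1.15)–(1.18)] [cite: MontgomeryVaughan2007, Theorem 9.13] -/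
theorem exists_chiFourMul_three (q : ℕ) [hq : Fact q.Prime] (hq2 : q ≠ 2) :
    ∃ χ : DirichletCharacter ℚ_[3] (4 * q), χ.IsPrimitive ∧ χ * χ = 1 ∧
      ∀ a : ℕ, χ (a : ZMod (4 * q)) = ((ZMod.χ₄ (a : ZMod 4) * J((a : ℤ) | q) : ℤ) : ℚ_[3]) := by
  haveI : NeZero (4 * q) := ⟨mul_ne_zero (by norm_num) hq.out.ne_zero⟩
  obtain ⟨χ4, h4sq, h4⟩ := exists_chiFour_three
  obtain ⟨χq, hχq⟩ := exists_legendreCharacter_three q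
  refine ⟨changeLevel (dvd_mul_right 4 q) χ4 * changeLevel (dvd_mul_left q 4) χq, ?_, ?_, fun a => ?_⟩
  · have hc4 : χ4.conductor = 4 := chiFour_isPrimitive χ4 h4
    have hcq : χq.conductor = q := conductor_eq_of_prime_of_ne_one χq (legendreChar_three_ne_one χq hχq hq2)
    have hcop : Nat.Coprime 4 q := by
      rw [show (4 : ℕ) = 2 ^ 2 by norm_num]
      exact Nat.Coprime.pow_left 2 ((Nat.coprime_primes Nat.prime_two hq.out).mpr (Ne.symm hq2))
    rw [isPrimitive_def, conductor_changeLevel_mul_changeLevel _ _ χ4 χq (by rw [hc4, hcq]; exact hcop), hc4, hcq]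
  · rw [mul_mul_mul_comm, ← map_mul, ← map_mul, h4sq, legendreChar_three_mul_self χq hχq, map_one, map_one, mul_one]
  · by_cases hu : IsCoprime (a : ℤ) ((4 * q : ℕ) : ℤ)
    · rw [show ((a : ℕ) : ZMod (4 * q)) = ((a : ℤ) : ZMod (4 * q)) by rw [Int.cast_natCast],
        MulChar.mul_apply, changeLevel_eq_cast_of_dvd' _ _ hu, changeLevel_eq_cast_of_dvd' _ _ hu,
        Int.cast_natCast, Int.cast_natCast, h4, hχq, jacobiSym.legendreSym.to_jacobiSym, Int.cast_mul]
    · have hnu : ¬ IsUnit ((a : ℕ) : ZMod (4 * q)) := by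
        rw [ZMod.isUnit_iff_coprime]; exact fun h => hu (Nat.isCoprime_iff_coprime.mpr h)
      rw [MulChar.map_nonunit _ hnu]
      have hc : ¬ a.Coprime (4 * q) := fun h => hu (Nat.isCoprime_iff_coprime.mpr h)
      rw [Nat.coprime_mul_iff_right, not_and_or] at hc
      rcases hc with h1 | h1
      · have h2 : ¬ a.Coprime 2 := fun h => h1 (by
          rw [show (4 : ℕ) = 2 ^ 2 by norm_num]; exact Nat.Coprime.pow_right 2 h)
        have hev : a % 2 = 0 := by
          rw [Nat.coprime_comm, Nat.Prime.coprime_iff_not_dvd Nat.prime_two, not_not] at h2; omega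
        rw [ZMod.χ₄_nat_eq_if_mod_four, if_pos hev]; simp
      · have hd : q ∣ a := by
          rwa [Nat.coprime_comm, Nat.Prime.coprime_iff_not_dvd hq.out, not_not] at h1
        rw [← jacobiSym.legendreSym.to_jacobiSym, (legendreSym.eq_zero_iff q (a : ℤ)).mpr (by
          rw [Int.cast_natCast]; exact (ZMod.natCast_eq_zero_iff _ _).mpr hd)]
        simp

/-- `χ_{4q}` at `3`: `χ₄(3)·J(3 | q) = −1` when `J(3 | q) = 1` (Kriz–Li (1) at `p_KL = 3`; for `q ≡ 3 (mod 4)` this is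
`q ≡ 11 (mod 12)`). [cite: KrizLi2019, Thm. 1.20 (1) (p. 7)] -/
theorem chiFourMul_val_three {q : ℕ} (h3 : J(3 | q) = 1) :
    (ZMod.χ₄ ((3 : ℕ) : ZMod 4) * J(((3 : ℕ) : ℤ) | q) : ℤ) = -1 := by
  have h1 : ZMod.χ₄ ((3 : ℕ) : ZMod 4) = -1 := by decide
  rw [h1, Nat.cast_ofNat, h3]; norm_num

/-- **`χ_{4q}` is EVEN for `q ≡ 3 (mod 4)`**: `χ(−1) = χ₄(4q − 1)·J(4q − 1 | q) = χ₄(−1)·J(−1 | q) = (−1)(−1)`.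
[cite: Cox2013, §1.C Lemma 1.14] -/
theorem chiFourMul_even {q : ℕ} [hq : Fact q.Prime] (hq4 : q % 4 = 3) (χ : DirichletCharacter ℚ_[3] (4 * q))
    (hχ : ∀ a : ℕ, χ (a : ZMod (4 * q)) = ((ZMod.χ₄ (a : ZMod 4) * J((a : ℤ) | q) : ℤ) : ℚ_[3])) : χ.Even := by
  haveI : NeZero (4 * q) := ⟨mul_ne_zero (by norm_num) hq.out.ne_zero⟩
  have hq1 : 1 ≤ 4 * q := by have := hq.out.two_le; omega
  show χ (-1) = 1
  have hneg : (-1 : ZMod (4 * q)) = ((4 * q - 1 : ℕ) : ZMod (4 * q)) := by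
    rw [Nat.cast_sub hq1, Nat.cast_one, ZMod.natCast_self, zero_sub]
  rw [hneg, hχ]
  -- `χ₄(4q − 1) = −1`
  have h4 : ZMod.χ₄ ((4 * q - 1 : ℕ) : ZMod 4) = -1 := by
    rw [ZMod.χ₄_nat_three_mod_four (by omega)]
  -- `J(4q − 1 | q) = J(−1 | q) = −1`
  have hJ : J(((4 * q - 1 : ℕ) : ℤ) | q) = -1 := by
    rw [Nat.cast_sub hq1, Nat.cast_mul, Nat.cast_ofNat, Nat.cast_one,
      show (4 : ℤ) * (q : ℤ) - 1 = -1 + (q : ℤ) * 4 by ring, jacobiSym.mod_left, Int.add_mul_emod_self_left,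
      ← jacobiSym.mod_left, jacobiSym.at_neg_one (Nat.odd_iff.mpr (by omega)), ZMod.χ₄_nat_three_mod_four hq4]
  rw [h4, hJ]; norm_num

/-- **`χ₄(ℓ)·J(ℓ | q) = J(q | ℓ)`** for odd `ℓ` and `q ≡ 3 (mod 4)` (quadratic reciprocity; the trace-form compatibility for
`d = q`: `y² = x³ + q·m²`). The cell's `chiFortyFour_eq_jacobiSym_eleven` with `11 ↦ q`. [cite: Cox2013, §1.C Lemma 1.14 and (1.15)–(1.18)] -/
theorem chiFourMul_eq_jacobiSym {q : ℕ} (hq4 : q % 4 = 3) {ℓ : ℕ} (hℓ : Odd ℓ) :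
    (ZMod.χ₄ (ℓ : ZMod 4) * J((ℓ : ℤ) | q) : ℤ) = J((q : ℤ) | ℓ) := by
  rw [← jacobiSym.at_neg_one hℓ]
  have := jacobiSym_neg_mul_jacobiSym_eq (m := 1) (r := q) hq4 hℓ
  simpa using this

end ChiFourMul

/-! ## §2 ★ The corner for a value-function `ψ` (the cell's plumbing, the Kriz–Li door at the end) -/

section ValuePsi

/-- ★ **QT27₊/X12₊ through the Kriz–Li door, for a VALUE-FUNCTION `ψ` and `K = ℚ(√−r)`.** For a primitive quadratic
`ℚ₃`-valued Dirichlet character `ψ` of level `f ⊥ 3` with integer values `v`, `v(3) = −1` (Kriz–Li (1)); a prime `r ≡ 3 (mod 4)`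
with `3` split in `K` (`J(−r | 3) = 1`) and every prime `ℓ ∣ f` split (`ℓ = 2 ⇒ r ≡ 7 (8)`, else `J(−r | ℓ) = 1`); a
globally minimal `W ≅ y² = x³ + d·m²` (`d` squarefree, `dm²` sixth-power-free) with the trace-form compatibility
`v(ℓ) = J(d | ℓ)` at primes `ℓ ≡ 1 (mod 3)`, `a₂(W) = 0` if good at `2`, each bad prime `= 3`, `∣ f`, or `≡ 1 (mod 3)` with
`v(ℓ) = −1`, `J(−r | ℓ) = 1`, and `r_an(W) ≠ 0`; `K` with `d_K = −r`; the Bernoulli binder `hB` for `ε_K = χ_r↑` (the cell's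
`bernoulli_hypothesis_three_of_even_values` / `…_of_odd_values` discharge it from two integer certificates): **`K` is Heegner for
`N(W)`, `L(W^{(d_K)}, 1) ≠ 0`, `r_an(W^{(d_K)}) = 0`** — MODULO `hKL`, `hGZ`, `hHP` only. The character/(1)/(3)/Heegner plumbing is
the cell `bsd-print-cfram`'s `bsdp_three_of_unitRegime_valuePsi`, verbatim; the end is the Kriz–Li door instead of Route U.
[cite: KrizLi2019, Thm. 1.20 (pp. 7–8), §7.1 (p. 42), §10.3] [cite: GrossZagier1986, Thm. I.(6.3), V.§1–2] [cite: Cox2013, §1.C Lemma 1.14] -/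
theorem heegner_and_twist_L_one_ne_zero_of_valuePsi (hKL : thm120_padicLogHeegner_unit_of_bernoulli)
    -- the character `ψ` by its values
    {f : ℕ} [hf : NeZero f] (ψ : DirichletCharacter ℚ_[3] f) (v : ℕ → ℤ)
    (hv : ∀ a : ℕ, ψ (a : ZMod f) = ((v a : ℤ) : ℚ_[3])) (hψp : ψ.IsPrimitive) (hψ2 : ψ * ψ = 1)
    (hf3 : f.Coprime 3) (hv3 : v 3 = -1)
    -- the Heegner prime `r` and its decidable numerics
    {r : ℕ} [hrp : Fact r.Prime] (hr4 : r % 4 = 3) (hs3 : jacobiSym (-(r : ℤ)) 3 = 1)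
    (hsf : ∀ ℓ : ℕ, ℓ.Prime → ℓ ∣ f → (ℓ = 2 → r % 8 = 7) ∧ (ℓ ≠ 2 → jacobiSym (-(r : ℤ)) ℓ = 1))
    (χr : DirichletCharacter ℚ_[3] r)
    (hχr : ∀ a : ℕ, χr (a : ZMod r) = (legendreSym r (a : ℤ) : ℚ_[3]))
    (W : WeierstrassCurve ℚ) [W.IsElliptic] [W.IsGloballyMinimal] [NeZero (W.conductorNorm ℤ)]
    -- the Mordell datum, trace-form compatibility, and the per-curve one-liners
    {d m : ℤ} (hd : Squarefree d) (hm : m ≠ 0)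
    (hW : ∃ C : VariableChange ℚ, C • W = mordellCurve ((d : ℚ) * (m : ℚ) ^ 2))
    (h6 : ∀ ℓ : ℕ, ℓ.Prime → ¬ ((ℓ : ℤ) ^ 6 ∣ d * m ^ 2))
    (hψval : ∀ ℓ : ℕ, ℓ.Prime → ℓ % 3 = 1 → v ℓ = jacobiSym d ℓ)
    (h2 : (haveI : Fact (Nat.Prime 2) := ⟨Nat.prime_two⟩; W.HasGoodReductionAtPrime 2) →
      W.LFunction 2 = 0)
    (hS : ∀ ℓ : ℕ, (hℓ : ℓ.Prime) → ¬ (haveI := Fact.mk hℓ; W.HasGoodReductionAtPrime ℓ) →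
      ℓ = 3 ∨ ℓ ∣ f ∨ (ℓ % 3 = 1 ∧ v ℓ = -1 ∧ jacobiSym (-(r : ℤ)) ℓ = 1))
    (hr1 : W.analyticRank ≠ 0)
    -- the Heegner field `ℚ(√−r)`, a Teichmüller `ω`, the Bernoulli binder, the three PRINT facts
    (K : Type) [Field K] [NumberField K] [NeZero (NumberField.discr K).natAbs]
    (hK : IsImaginaryQuadratic K) (hdK : NumberField.discr K = -(r : ℤ)) (hrd : r ∣ (NumberField.discr K).natAbs)
    (ω : DirichletCharacter ℚ_[3] 3) (hω : IsTeichmullerCharacter ω)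
    (hB : ¬ (‖bernoulliOnePrim (bernoulliCharOne ψ (changeLevel hrd χr)) *
        bernoulliOnePrim (bernoulliCharTwo ψ (changeLevel hrd χr) ω)‖ ≤ ((3 : ℕ) : ℝ)⁻¹))
    (hGZ : gross_zagier (W.conductorNorm ℤ) W K) (hHP : exists_isHeegnerPoint W K) :
    SatisfiesHeegnerHypothesis (W.conductorNorm ℤ) K ∧
      (W.quadraticTwist (NumberField.discr K : ℚ)).entireLFunction 1 ≠ 0 ∧
      (W.quadraticTwist (NumberField.discr K : ℚ)).analyticRank = 0 := by
  haveI : Fact (Nat.Prime 3) := ⟨Nat.prime_three⟩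
  have hr2 : r ≠ 2 := by omega
  have hωne : ω ≠ 1 := ne_one_of_isTeichmullerCharacter (p := 3) (by norm_num) hω
  have hinv : ψ⁻¹ = ψ := inv_eq_of_mul_eq_one_right hψ2
  have hcond : (invMulOmega ψ ω).conductor = f * 3 :=
    conductor_invMulOmega_of_isPrimitive ψ ω hψp hf3 hωne
  -- `j(W) = 0`
  have hj : W.j = 0 := by
    obtain ⟨C, hC⟩ := hW
    have hc4 : (C • W).c₄ = 0 := by rw [hC, mordellCurve_c₄]
    have h1' : (C • W).j = W.j := variableChange_j W C
    have h2' : (C • W).j = 0 := by rw [WeierstrassCurve.j, hc4]; simp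
    rw [← h1', h2']
  -- `hss` from the trace form (`ψ(ℓ) = v(ℓ) = J(d | ℓ)` at `ℓ ≡ 1 (mod 3)`)
  have hss := hss_three_of_mordell_int W hd hm hW h6 h2 ψ ω hω hψ2 (fun ℓ hℓ _ hℓ1 => by
    rw [hv, hψval ℓ hℓ hℓ1])
  -- the Heegner hypothesis: every bad prime splits in `ℚ(√−r)`
  have hHN : SatisfiesHeegnerHypothesis (W.conductorNorm ℤ) K := by
    intro p hp hpN
    haveI := Fact.mk hp
    have hbad : ¬ W.HasGoodReductionAtPrime p := fun hgood =>
      not_dvd_conductorNorm_of_hasGoodReductionAtPrime W hgood hpN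
    rcases hS p hp hbad with h3 | hpf | ⟨hp1, -, hJ⟩
    · rw [h3] at hp ⊢
      exact ncard_primesOver_eq_two_of_jacobiSym_neg hK.1 hdK hp (by norm_num) hs3
    · by_cases hp2 : p = 2
      · subst hp2
        rw [Nat.cast_ofNat, Quadratic.ncard_primesOver_two_eq_two_iff hK.1, hdK]
        have := (hsf 2 hp hpf).1 rfl
        omega
      · exact ncard_primesOver_eq_two_of_jacobiSym_neg hK.1 hdK hp hp2 ((hsf p hp hpf).2 hp2)
    · exact ncard_primesOver_eq_two_of_jacobiSym_neg hK.1 hdK hp (by omega) hJ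
  -- (1a): `ψ(3) = v(3) = −1 ≠ 1`
  have h1a : ψ (3 : ZMod f) ≠ 1 := by
    rw [show (3 : ZMod f) = ((3 : ℕ) : ZMod f) by norm_cast, hv, hv3]; norm_num
  -- (1b): `3 ∣ f(ψ⁻¹ω) = 3f`
  have h1b : primVal (invMulOmega ψ ω) 3 ≠ 1 := by
    apply primVal_ne_one_of_not_coprime
    rw [hcond]
    intro hc
    have := Nat.Coprime.coprime_mul_left_right hc
    norm_num at this
  refine ⟨hHN, twist_L_one_ne_zero_of_thm120_three W K hKL hj hr1 hK hHN hGZ hHP f ψ ω hψp hω hss h1a h1b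
    (fun ℓ hℓ hℓ3 hbad => ?_) (changeLevel hrd χr) (isKroneckerCharacterOf_legendre hr4 hK.1 hdK χr hχr hrd) hB⟩
  -- (3) at the additive primes `ℓ ≠ 3`
  rcases hS ℓ hℓ hbad.1 with h3 | hℓf | ⟨hℓ1, hvℓ, -⟩
  · exact absurd h3 hℓ3
  · -- `ℓ ∣ f`: both characters vanish at `ℓ`
    have hncop : ¬ ℓ.Coprime f := fun hc => hℓ.one_lt.ne' (Nat.Coprime.eq_one_of_dvd hc hℓf)
    refine ⟨?_, ?_⟩
    · rw [hv, val_eq_zero_of_not_coprime ψ v hv hncop, Int.cast_zero]; exact zero_ne_one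
    · apply primVal_ne_one_of_not_coprime
      rw [hcond]
      exact fun hc => hncop (Nat.Coprime.coprime_mul_right_right hc)
  · -- `ℓ ≡ 1 (mod 3)` with `v(ℓ) = −1`: `ψ(ℓ) = −1`, `(ψ⁻¹ω)(ℓ) = −ω(ℓ) = −1`
    have hval : ψ (ℓ : ZMod f) = -1 := by rw [hv, hvℓ]; norm_num
    have hω1 : ω (ℓ : ZMod 3) = 1 := by
      have := teichmuller_three_apply_of_emod_eq_one hω (ℓ : ℤ) (by exact_mod_cast hℓ1)
      simpa [Int.cast_natCast] using this
    have hℓf : ℓ.Coprime f := by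
      by_contra hnc
      have h0 := val_eq_zero_of_not_coprime ψ v hv hnc
      rw [hvℓ] at h0; norm_num at h0
    have hcop : ℓ.Coprime (f * 3) :=
      Nat.Coprime.mul_right hℓf ((Nat.coprime_primes hℓ Nat.prime_three).mpr hℓ3)
    refine ⟨by rw [hval]; norm_num, ?_⟩
    rw [primVal_invMulOmega_of_coprime_level ψ ω hcop, hinv, hval, hω1]
    norm_num

end ValuePsi

/-! ## §3 ★ The prime pair `(q, −r)` with `q ≡ 3 (mod 4)`: `ψ = χ₄·(·/q)`, bad primes `⊂ {2, 3, q}` -/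

section PrimePairThreeModFour

/-- ★ **X12₊ ∪ QT27₊ at `q ≡ 11 (mod 12)` through the Kriz–Li door, for a PRIME PAIR `(q, −r)`.** For primes `q ≡ 3 (mod 4)`
with `J(3 | q) = 1` (⟺ `q ≡ 11 (mod 12)`: Kriz–Li (1) for `ψ = χ₄·(·/q)`, and CM-inert) and `r ≡ 7 (mod 8)`, `r ≠ 3`, with
`J(−r | 3) = J(−r | q) = 1` (`2`, `3`, `q` split in `ℚ(√−r)`) and the two integer certificates
`3 ∤ S₁ = Σ_{j<4qr} χ₄(j)(j/q)(j/r)·j` (`⟺ 3 ∤ h(−4qr)`), `3 ∥ S₂ = Σ_{j<12q} χ₄(j)(j/q)(j/3)·j` (`⟺ 3 ∤ h(−12q)`): for every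
globally minimal `W ≅ y² = x³ + q·m²` (`qm²` sixth-power-free; `36a1^{(q)} = x³ + q³` is `m = q`, `27a^{(q)}` is `m = 4q`) with
`a₂(W) = 0` if good at `2`, bad primes `⊂ {2, 3, q}`, `r_an(W) ≠ 0`, and `K` with `d_K = −r`: **`K` is Heegner for `N(W)`,
`L(W^{(−r)}, 1) ≠ 0`, `r_an(W^{(−r)}) = 0`** — MODULO `hKL`, `hGZ`, `hHP` only.
[cite: KrizLi2019, Thm. 1.20 (pp. 7–8), §1.5 (1), §10.3] [cite: GrossZagier1986, Thm. I.(6.3), V.§1–2]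
[cite: Cox2013, §1.C Lemma 1.14 and (1.15)–(1.18)] [cite: Washington1997, Thm. 4.2] -/
theorem heegner_and_twist_L_one_ne_zero_of_prime_pair_three_mod_four (hKL : thm120_padicLogHeegner_unit_of_bernoulli)
    {q r : ℕ} [hq : Fact q.Prime] [hrp : Fact r.Prime] (hq4 : q % 4 = 3) (h3q : jacobiSym 3 q = 1)
    (hr8 : r % 8 = 7) (hr3 : r ≠ 3) (hs3 : jacobiSym (-(r : ℤ)) 3 = 1) (hsq : jacobiSym (-(r : ℤ)) q = 1)
    (hS₁ : ¬ ((3 : ℤ) ∣ ∑ j ∈ Finset.range (4 * q * r),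
      (ZMod.χ₄ (j : ZMod 4) * J((j : ℤ) | q) : ℤ) * jacobiSym (j : ℤ) r * (j : ℤ)))
    (hS₂ : (3 : ℤ) ∣ ∑ j ∈ Finset.range (4 * q * 3),
      (ZMod.χ₄ (j : ZMod 4) * J((j : ℤ) | q) : ℤ) * jacobiSym (j : ℤ) 3 * (j : ℤ) ^ (0 + 1))
    (hS₂' : ¬ ((3 : ℤ) ^ 2 ∣ ∑ j ∈ Finset.range (4 * q * 3),
      (ZMod.χ₄ (j : ZMod 4) * J((j : ℤ) | q) : ℤ) * jacobiSym (j : ℤ) 3 * (j : ℤ) ^ (0 + 1)))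
    (W : WeierstrassCurve ℚ) [W.IsElliptic] [W.IsGloballyMinimal] [NeZero (W.conductorNorm ℤ)]
    {m : ℤ} (hm : m ≠ 0) (hW : ∃ C : VariableChange ℚ, C • W = mordellCurve ((q : ℚ) * (m : ℚ) ^ 2))
    (h6 : ∀ ℓ : ℕ, ℓ.Prime → ¬ ((ℓ : ℤ) ^ 6 ∣ (q : ℤ) * m ^ 2))
    (h2 : (haveI : Fact (Nat.Prime 2) := ⟨Nat.prime_two⟩; W.HasGoodReductionAtPrime 2) →
      W.LFunction 2 = 0)
    (hS : ∀ ℓ : ℕ, (hℓ : ℓ.Prime) → ¬ (haveI := Fact.mk hℓ; W.HasGoodReductionAtPrime ℓ) →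
      ℓ = 2 ∨ ℓ = 3 ∨ ℓ = q)
    (hr1 : W.analyticRank ≠ 0)
    (K : Type) [Field K] [NumberField K] (hK : IsImaginaryQuadratic K) (hdK : NumberField.discr K = -(r : ℤ))
    (hGZ : gross_zagier (W.conductorNorm ℤ) W K) (hHP : exists_isHeegnerPoint W K) :
    SatisfiesHeegnerHypothesis (W.conductorNorm ℤ) K ∧
      (W.quadraticTwist (NumberField.discr K : ℚ)).entireLFunction 1 ≠ 0 ∧
      (W.quadraticTwist (NumberField.discr K : ℚ)).analyticRank = 0 := by
  haveI : NeZero (4 * q) := ⟨mul_ne_zero (by norm_num) hq.out.ne_zero⟩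
  haveI : NeZero (NumberField.discr K).natAbs := ⟨Int.natAbs_ne_zero.mpr (NumberField.discr_ne_zero K)⟩
  have hq2 : q ≠ 2 := by omega
  have hq3 : q ≠ 3 := by
    rintro rfl
    rw [jacobiSym.mod_left] at h3q
    norm_num [jacobiSym.zero_left] at h3q
  have hr4 : r % 4 = 3 := by omega
  obtain ⟨χ, hχp, hχ2, hχ⟩ := exists_chiFourMul_three q hq2
  obtain ⟨χr, hχr⟩ := exists_legendreCharacter_three r
  obtain ⟨ω, hω⟩ := exists_isTeichmullerCharacter (p := 3)
  have hrd : r ∣ (NumberField.discr K).natAbs := by rw [hdK, Int.natAbs_neg, Int.natAbs_natCast]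
  have hsqf : Squarefree (q : ℤ) := by rw [Int.squarefree_natCast]; exact hq.out.squarefree
  have hf3 : (4 * q).Coprime 3 :=
    Nat.Coprime.mul_left (by norm_num) ((Nat.coprime_primes hq.out Nat.prime_three).mpr hq3)
  have hfr : (4 * q).Coprime r := by
    refine Nat.Coprime.mul_left ?_ ((Nat.coprime_primes hq.out hrp.out).mpr ?_)
    · rw [show (4 : ℕ) = 2 ^ 2 by norm_num]
      exact Nat.Coprime.pow_left 2 ((Nat.coprime_primes Nat.prime_two hrp.out).mpr (by omega))
    · rintro rfl
      rw [jacobiSym.mod_left, show (-(q : ℤ)) % q = 0 by simp, jacobiSym.zero_left hq.out.one_lt] at hsq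
      norm_num at hsq
  refine heegner_and_twist_L_one_ne_zero_of_valuePsi hKL χ (fun a => (ZMod.χ₄ (a : ZMod 4) * J((a : ℤ) | q) : ℤ)) hχ
    hχp hχ2 hf3 (chiFourMul_val_three h3q) (r := r) hr4 hs3 (fun ℓ hℓ hℓf => ?_) χr hχr W hsqf hm
    (by exact_mod_cast hW) (by exact_mod_cast h6) (fun ℓ hℓ hℓ1 => ?_) h2 (fun ℓ hℓ hbad => ?_) hr1 K hK hdK hrd ω hω
    (bernoulli_hypothesis_three_of_even_values χ (fun a => (ZMod.χ₄ (a : ZMod 4) * J((a : ℤ) | q) : ℤ)) χr ω hχ hχ2 hχp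
      hχr hω hfr hf3 (by omega) hr3 hrd (chiFourMul_even hq4 χ hχ) hS₁ hS₂ hS₂') hGZ hHP
  · -- the conductor primes `2`, `q` split in `ℚ(√−r)`
    rcases (Nat.Prime.dvd_mul hℓ).mp hℓf with h4 | hq'
    · have h2' : ℓ = 2 :=
        (Nat.prime_dvd_prime_iff_eq hℓ Nat.prime_two).mp (hℓ.dvd_of_dvd_pow (n := 2) (by simpa using h4))
      exact ⟨fun _ => hr8, fun h => absurd h2' h⟩
    · have hq'' : ℓ = q := (Nat.prime_dvd_prime_iff_eq hℓ hq.out).mp hq'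
      subst hq''
      exact ⟨fun h => absurd h hq2, fun _ => hsq⟩
  · -- trace-form compatibility `χ₄(ℓ)·J(ℓ | q) = J(q | ℓ)` at odd `ℓ`
    have := chiFourMul_eq_jacobiSym hq4 (hℓ.odd_of_ne_two (by omega))
    exact_mod_cast this
  · rcases hS ℓ hℓ hbad with h | h | h
    · exact Or.inr (Or.inl (by rw [h]; exact dvd_mul_of_dvd_left (by norm_num) _))
    · exact Or.inl h
    · exact Or.inr (Or.inl (by rw [h]; exact dvd_mul_left q 4))

/-- ★ **The crux's `∃ K′` at `(W, q)`, `q ≡ 11 (mod 12)`, from a prime-pair certificate `(r; S₁, S₂)` with `h(−r) < q`** — the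
field `K′ = ℚ(√−r)` PRODUCED in the tree (`SylvesterCorner.exists_field_of_odd`), the three named facts taken for all `K`.
[cite: KrizLi2019, Thm. 1.20 (pp. 7–8)] [cite: GrossZagier1986, Thm. I.(6.3), V.§1–2] [cite: Cox2013, §2.A Thm. 2.13; §7.B Thm. 7.7(ii)] -/
theorem exists_cruxConclusion_of_prime_pair_three_mod_four (hKL : thm120_padicLogHeegner_unit_of_bernoulli)
    (hGZ : ∀ (N : ℕ) [NeZero N] (W : WeierstrassCurve ℚ) (K : Type) [Field K] [NumberField K], gross_zagier N W K)
    (hHP : ∀ (W : WeierstrassCurve ℚ) (K : Type) [Field K] [NumberField K], exists_isHeegnerPoint W K)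
    {q r : ℕ} [hq : Fact q.Prime] [hrp : Fact r.Prime] (hq4 : q % 4 = 3) (h3q : jacobiSym 3 q = 1)
    (hr8 : r % 8 = 7) (hr3 : r ≠ 3) (hs3 : jacobiSym (-(r : ℤ)) 3 = 1) (hsq : jacobiSym (-(r : ℤ)) q = 1)
    (hS₁ : ¬ ((3 : ℤ) ∣ ∑ j ∈ Finset.range (4 * q * r),
      (ZMod.χ₄ (j : ZMod 4) * J((j : ℤ) | q) : ℤ) * jacobiSym (j : ℤ) r * (j : ℤ)))
    (hS₂ : (3 : ℤ) ∣ ∑ j ∈ Finset.range (4 * q * 3),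
      (ZMod.χ₄ (j : ZMod 4) * J((j : ℤ) | q) : ℤ) * jacobiSym (j : ℤ) 3 * (j : ℤ) ^ (0 + 1))
    (hS₂' : ¬ ((3 : ℤ) ^ 2 ∣ ∑ j ∈ Finset.range (4 * q * 3),
      (ZMod.χ₄ (j : ZMod 4) * J((j : ℤ) | q) : ℤ) * jacobiSym (j : ℤ) 3 * (j : ℤ) ^ (0 + 1)))
    {h : ℕ} (hclass : BinQF.classNumber (-(r : ℤ)) = h) (hhq : h < q)
    (W : WeierstrassCurve ℚ) [W.IsElliptic] [W.IsGloballyMinimal] [NeZero (W.conductorNorm ℤ)]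
    {m : ℤ} (hm : m ≠ 0) (hW : ∃ C : VariableChange ℚ, C • W = mordellCurve ((q : ℚ) * (m : ℚ) ^ 2))
    (h6 : ∀ ℓ : ℕ, ℓ.Prime → ¬ ((ℓ : ℤ) ^ 6 ∣ (q : ℤ) * m ^ 2))
    (h2 : (haveI : Fact (Nat.Prime 2) := ⟨Nat.prime_two⟩; W.HasGoodReductionAtPrime 2) →
      W.LFunction 2 = 0)
    (hS : ∀ ℓ : ℕ, (hℓ : ℓ.Prime) → ¬ (haveI := Fact.mk hℓ; W.HasGoodReductionAtPrime ℓ) →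
      ℓ = 2 ∨ ℓ = 3 ∨ ℓ = q)
    (hr1 : W.analyticRank ≠ 0) :
    ∃ (K : Type) (_ : Field K) (_ : NumberField K),
      IsImaginaryQuadratic K ∧ 4 < (NumberField.discr K).natAbs ∧
      SatisfiesHeegnerHypothesis (W.conductorNorm ℤ) K ∧
      (W.quadraticTwist (NumberField.discr K : ℚ)).entireLFunction 1 ≠ 0 ∧ ¬ q ∣ NumberField.classNumber K := by
  have hr0 : (-(r : ℤ)) < 0 := by have := hrp.out.pos; omega
  have hr4' : (-(r : ℤ)) % 4 = 1 := by omega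
  have hsf : Squarefree (-(r : ℤ)).natAbs := by
    rw [Int.natAbs_neg, Int.natAbs_natCast]; exact hrp.out.squarefree
  obtain ⟨K, iF, iN, hK, hdK, hhK⟩ := SylvesterCorner.exists_field_of_odd (-(r : ℤ)) h hr0 hr4' hsf hclass
  obtain ⟨hHN, hL, -⟩ := heegner_and_twist_L_one_ne_zero_of_prime_pair_three_mod_four hKL hq4 h3q hr8 hr3 hs3 hsq hS₁ hS₂
    hS₂' W hm hW h6 h2 hS hr1 K hK hdK (hGZ _ W K) (hHP W K)
  have hr7 : 4 < r := by have := hrp.out.two_le; omega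
  refine ⟨K, iF, iN, hK, by rw [hdK, Int.natAbs_neg, Int.natAbs_natCast]; exact hr7, hHN, hL, fun hdvd => ?_⟩
  have hh : NumberField.classNumber K < q := by rw [hhK]; exact hhq
  exact absurd (Nat.le_of_dvd (NumberField.classNumber_pos (K := K)) hdvd) (not_le.mpr hh)

end PrimePairThreeModFour

end Summit.BirchSwinnertonDyer.BirchSwinnertonDyer.Theorems.KrizLiCornerX12

end
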